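import Summits.ResolutionOfSingularities.ResolutionOfSingularities.Theorems.MaxContactCutHistoryCut
import Summits.ResolutionOfSingularities.ResolutionOfSingularities.Theorems.WallCutCells
import HarnessLib

/-!
# MaxContactCutWallCutCells — (file name `MaxContactCutWallCutCells`: the tree already has a `MaxContactCutWallCut` from the earlier lens-4 «WallCut» classes node) decomp-res node «WallCut» (lens-4 g30, critic rows 176/176a CLEARED DECIDED +1), tree file
8/8 of the node

Content VERBATIM from the decomp-res lens-4 g30 node `HOME/decomp-res-lens-4/g30/WallCut.lean` (pin c43ccc48;
imports the landed tree only, carries nothing);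
HOME = run/shared/lean/pub/decomp-res; critic rows 176/176a CLEARED DECIDED +1; landing orders INBOX :819 —
provenance, critic text and the lens header in full in the first file of the
node, `WallAlgebra`.  Namespace `…Theorems.HugValuationCut`; `--supports stmt-ResolutionOfSingularities-28338`.

## This file

THE FOUR §86 COROLLARIES GIVEN 31571 `MaxContactCut.NoContactHuggingTowers` BY NAME (in the Theses cone):
`noWildKangarooOffDoublePointTowers_iff_g30 (h71)` · `noWildKangarooOffLocusTowers_iff_g30 (h71)` ·
`noWildPPowerOffLocusTowers_iff_g30 (h71)` · `noWildContactFreeOffLocusTowers_iff_g30 (h71)` — TREE ASIDE 28338 /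
the g25–g29 residuals ⟺ the g30 located residual (the walled cell being decided), through
`MaxContactCutSatelliteCut`'s / `MaxContactCutHistoryCut`'s `…(h71)` families and the hypothesis-free
`noWildFreshJumpShallowCompanionKangarooTowers_iff_g30`.  Imports `MaxContactCutHistoryCut` + `WallCutCells`; 0 sorry.

[WRITER NOTE (decomp-res writer g11): file split only (tree files ≤ 400 lines); namespace, universes, sections,
section variables and every declaration
exactly as in the lens (the node's global dupNamespace-linter line is dropped — the library sets it; the `open
…Theses` line lives only in the Theses-cone file;
`set_option maxHeartbeats … in` prefixes of single declarations are kept VERBATIM).  ONE deletion (gate dedup rule,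
critic :835 watch-list): the node's private copy of
isUnit_add_of_mem_maximalIdeal` is NOT re-landed — it is LITERALLY the landed
`Literature.AlgebraicGeometry.Resolution.isUnit_add_of_mem_maximalIdeal` (`WeightedInitialTerms`,
imported; the namespace is opened as in the lens), which the transport proofs now cite by the same short name.
SECOND deletion (gate dedup bounce p810318):
the node's `range_triple` is NOT re-landed — it is LITERALLY the landed
`…Cruxes.HypersurfaceCentreConstruction.LocalEngine.Iota3.range_vec₃`
(`Theorems/WeightedInvariantIota3FlagTools`, imported from `WallAlgebra2` on; aliased by an explicit `open …
(range_vec₃)`), cited by name at its two uses.]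

(Sources: Hauser2010Kangaroo (arXiv:0811.4151, Kangaroo Theorem condition (3)); HauserPerlega2019 §2; Hauser2024
PRIMS 60; Moh1987; Perlega2023; Matsumura1987 Thms. 14.2–14.3, 19.x; ZariskiSamuel1960 VIII §11; StacksProject Tags
0804, 0BIQ, 00NQ, 0AGS; DeJong1996 2.4; CossartPiltant2008 §2; Giraud1975.)
-/

noncomputable section

open CategoryTheory AlgebraicGeometry IsLocalRing
open Literature.AlgebraicGeometry.Resolution
open Summit.ResolutionOfSingularities.ResolutionOfSingularities.Theses
open Summit.ResolutionOfSingularities.ResolutionOfSingularities.Theorems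
open WeakOrderReduction ForcedTowerClasses DivergentTowerClasses MonomialTowerClasses
open HugDimensionClasses HugDimensionKernels SurfaceShadowClasses SurfaceShadowKernels
open NearPointCut (SingularClass)
open scoped BigOperators

namespace Summit.ResolutionOfSingularities.ResolutionOfSingularities.Theorems.HugValuationCut

section WallCells

/-- **GIVEN 31571 BY NAME: the g25 residual ⟺ the wall-free residual.** [folklore] -/
theorem noWildKangarooOffDoublePointTowers_iff_g30 (h71 : MaxContactCut.NoContactHuggingTowers) :
    NoWildKangarooOffDoublePointTowers ↔ NoWildWallFreeFreshJumpShallowCompanionKangarooTowers :=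
  (noWildKangarooOffDoublePointTowers_iff_g28 h71).trans noWildFreeJumpShallowCompanionKangarooTowers_iff_g30

/-- **GIVEN 31571 BY NAME: g24's kangaroo residual ⟺ the wall-free residual.** [folklore] -/
theorem noWildKangarooOffLocusTowers_iff_g30 (h71 : MaxContactCut.NoContactHuggingTowers) :
    NoWildKangarooOffLocusTowers ↔ NoWildWallFreeFreshJumpShallowCompanionKangarooTowers :=
  (noWildKangarooOffLocusTowers_iff_g28 h71).trans noWildFreeJumpShallowCompanionKangarooTowers_iff_g30

/-- **GIVEN 31571 BY NAME: g23's `p`-power residual ⟺ the wall-free residual.** [folklore] -/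
theorem noWildPPowerOffLocusTowers_iff_g30 (h71 : MaxContactCut.NoContactHuggingTowers) :
    NoWildPPowerOffLocusTowers ↔ NoWildWallFreeFreshJumpShallowCompanionKangarooTowers :=
  (noWildPPowerOffLocusTowers_iff_g28 h71).trans noWildFreeJumpShallowCompanionKangarooTowers_iff_g30

/-- **GIVEN 31571 BY NAME, THE TREE ASIDE 28338 ⟺ THE g30 RESIDUAL** — `NoWildContactFreeOffLocusTowers` ⟺ the wall-free
fresh-jump shallow companion-recurrent residual. [folklore] -/
theorem noWildContactFreeOffLocusTowers_iff_g30 (h71 : MaxContactCut.NoContactHuggingTowers) :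
    NoWildContactFreeOffLocusTowers ↔ NoWildWallFreeFreshJumpShallowCompanionKangarooTowers :=
  (noWildContactFreeOffLocusTowers_iff_g28 h71).trans noWildFreeJumpShallowCompanionKangarooTowers_iff_g30

end WallCells

end Summit.ResolutionOfSingularities.ResolutionOfSingularities.Theorems.HugValuationCut
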